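import Literature.AnabelianGeometry.EtaleTheta.ArithThetaTowerFrobenioid
import Literature.AlgebraicGeometry.Frobenioids.ArithmeticFrobenioidNonDilating
import Mathlib.GroupTheory.OrderOfElement
import HarnessLib

/-!
# [IUTchI] Ex. 3.2 (i) / [EtTh] Def. 3.6 (ii) at the arithmetic theta tower: the seventh clause of S0 —
# `CarrierSpec.PullDichotomy` (RULINGS #339 (ρ2)/(3)), the non-dilating lever it yields ([FrdI] Def. 1.1 (i)),
# and the named dischargers of `CarrierSpec.lZ` / `CarrierSpec.aut_finite` (every tempered Frobenioid)

S. Mochizuki, *The geometry of Frobenioids I*, Kyushu J. Math. **62** (2008) [MochizukiFrdI2008], Def. 1.1 (i) p.19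
(non-dilating endomorphisms), Thm. 6.4 (i); *The étale theta function …*, Publ. RIMS **45** (2009) [MochizukiEtTh2009],
Def. 3.6 (ii) p.77, Prop. 3.4 (i) p.74 ("every endomorphism of `Φ₀(Y^log)` … induced by an endomorphism of `Y^log` over
`X^log` is non-dilating") [cite: MochizukiFrdI2008, Def. 1.1 (i) p.19].

GAP A of record G-L5-EX32I-1, item GA-04 ADD-ON (abc-iut cell; RULINGS #339 (3), 2026-08-28T21:03Z): the S0 decoupling
spec `ArithThetaTower.CarrierSpec` (`ArithThetaTowerFrobenioid.lean`, ★ p667989) landed with six fields BEFORE the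
chair's ruling ρ2 added a seventh, index-free, class-(i) clause.  Per #339 (3) the landed structure is NOT edited; the
clause lands here as the named predicate **`ArithThetaTower.CarrierSpec.PullDichotomy C`** (same statement), and the
§5 D8 item reads `isNonDilating_of_carrierSpec (hC : CarrierSpec d T C) (hD : CarrierSpec.PullDichotomy C)`
(countersigned SIG-DELTA on D8 only; GA-12 lands `pullDichotomy_temperedFrobenioid d T` at the term; GA-07 passes it).

* `CarrierSpec.PullDichotomy C` — for EVERY object `A` and EVERY endomorphism `f : A ⟶ A` of the base (no finite-index
  hypothesis): the pull-back `Φ(f)` of the divisor monoid is EITHER the identity of `Φ(A)` OR carries some PRIMARY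
  element off itself (`¬ Φ(f)(a) ≼ a`) — the shape of `ZTower.phiZeroPull_dichotomy` (`LogDivisorModelZTowerRays.lean`),
  which the tree proved for the INFINITE `ℤ`-tower.  Stated for a tempered Frobenioid over ANY base `D` (used at
  `D := T.Dv = CosetCat Π_v̲`).
* `CarrierSpec.PullDichotomy.isNonDilating_pull` — the H+ LEVER: the dichotomy makes `Φ(f)` non-dilating in the sense
  of [FrdI] Def. 1.1 (i) at every object, by `isNonDilating_of_forall_isPrimary` (`ArithmeticFrobenioidNonDilating.lean`;
  `Φ(A)` is sharp because it is perf-factorial in the weak vocabulary) — the pattern of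
  `TemperedFrobenioid.DiagonalBase.isNonDilating_pull_of_dichotomy` (`BiKummerThm44HypOfGaloisCoveringZTowerAll.lean`),
  now vocabulary-level; GA-08's `isNonDilating_of_carrierSpec hC hD := hD.isNonDilating_pull` is then a one-liner at
  EVERY object, binder-free as ruled (#339 (2)).
* The NAMED DISCHARGERS of two S0 fields that hold for EVERY tempered Frobenioid (crit-A (C3) satisfiability witnesses,
  so that GA-12 only cites them): `deckLiftLin A : Aut A →* Aut (A, 0)` — the deck transformations of `A` lift BY NAME as
  the linear automorphisms `(1, σ, 0, 1)` of the Frobenius-trivial object of the model Frobenioid ([FrdI] Thm. 5.2 (i),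
  proof p.101) — with `exists_deckLift` = `CarrierSpec.lZ` at `A := Ÿ_T`; and `aut_finite_holds` = `CarrierSpec.aut_finite`:
  an endomorphism of a FINITE-INDEX object `P/U` of `CosetCat P` is surjective hence bijective on the finite set `P/U`,
  so an automorphism (`CosetCat.isIso_of_end`), its underlying permutation has finite order
  (`CosetCat.exists_endIter_eq_id`), and `Φ` is functorial (`SubMonoidOn.pull_comp_apply`/`pull_id_apply`), so the induced
  endomorphism of `Φ(P/U)` has finite order.

Discharger at the term (GA-12, RULINGS #339 (1), verbatim): «on `Φ₀^geom(P/U) = ℕ^{U-orbits of (C × Bool) ⊔ C}` (GA-10,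
`Div = ⊤`) the pull along `gU ↦ g·n·U` (`U ≤ nUn⁻¹`) is `O ↦ n·O` — either every `U`-orbit is `n`-fixed (identity) or
some `O` has `n·O ≠ O` and then `n·O ⊄ O` (else `O = U·(nc) ⊆ nUn⁻¹·(nc) = n·O`), so the primary `e_O` witnesses; on
the `OrdInt (Ω^{aug U})` coordinate the pull is the identity by `GaloisValDatum.valuation_gal_eq`/`v_map` (GA-01 ★
p667500); product witness `(e_O, 0)`».

HONEST FRAMING: a `Prop`-valued predicate and elementary lemmas about monoids on a category, model Frobenioids and
coset categories; TYPED ≠ INHABITED;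
nothing here constructs the carrier or asserts the dichotomy holds at it (GA-12); an UNDISPUTED construction around
[IUTchIII] Cor. 3.12, which stays OPEN by charter (D-0045) — no side taken on it or on any author; nothing here asserts
the abc conjecture proved or refuted; count-neutral.  No instance, no notation, no attribute manipulation, no `sorry`.
-/

namespace Literature.AnabelianGeometry.EtaleTheta

namespace ArithThetaTower

open CategoryTheory Opposite Function Literature.AlgebraicGeometry.Frobenioids Literature.AnabelianGeometry.SemiGraphs

universe u₀ v₀ u v w

variable {D₀ : Type u₀} [Category.{v₀} D₀] {V : FrdIMonoidStub.{w}} {T' : RealifiedDivisorMonoids (D₀ := D₀) V}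
  {D : Type u} [Category.{v} D] {VD : FrdICatStub.{u, v, w} D}

/-- **The seventh clause of S0** (RULINGS #339 (ρ2); class (i), index-free): for every object `A` of the base and every
endomorphism `f : A ⟶ A`, the pull-back `Φ(f) : Φ(A) → Φ(A)` of the divisor monoid is EITHER the identity OR carries
some primary element of `Φ(A)` off itself, `¬ Φ(f)(a) ≼ a` — so the dilation premise of [FrdI] Def. 1.1 (i) fails
unless `Φ(f) = id` (shape of `ZTower.phiZeroPull_dichotomy`).  At the GAP-A carrier (`D = 𝒟_v̲ = CosetCat Π_v̲`) the
§5 D8 item takes `(hD : CarrierSpec.PullDichotomy C)` next to `(hC : CarrierSpec d T C)` (#339 (3)).  Discharger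
(GA-12, #339 (1)): on `Φ₀^geom(Π/U) = ℕ^{U-orbits}` the pull along `gU ↦ g·n·U` is `O ↦ n·O` — identity, or a
`U`-orbit `O` with `n·O ⊄ O` whose primary `e_O` witnesses; identity on the `OrdInt (Ω^{aug U})` coordinate
(`GaloisValDatum.valuation_gal_eq`). [cite: MochizukiFrdI2008, Def. 1.1 (i) p.19] -/
def CarrierSpec.PullDichotomy (C : TemperedFrobenioid T' D VD) : Prop :=
  ∀ (A : Dᵒᵖ) (f : A ⟶ A),
    (∀ a : C.Φ.carrier A, C.Φ.pull f a = a) ∨ ∃ a : C.Φ.carrier A, IsPrimary a ∧ ¬ Precsim (C.Φ.pull f a) a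

/-- **The H+ lever** ([FrdI] Def. 1.1 (i); [EtTh] Prop. 3.4 (i) "non-dilating"; RULINGS #319 H+ / #339 (2)): over the weak
[FrdI] vocabulary (where `Φ(A)` is perf-factorial, hence divisorial and SHARP), the pull-back dichotomy makes every
`Φ(f)`, `f : A ⟶ A`, NON-DILATING at EVERY object — no finite-index hypothesis: if `Φ(f)` is the identity there is
nothing to show; otherwise the dilation premise «`Φ(f)(a) ≼ a` for every primary `a`» is refuted by the witness
(`isNonDilating_of_forall_isPrimary`; pattern `TemperedFrobenioid.DiagonalBase.isNonDilating_pull_of_dichotomy`).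
GA-08's `isNonDilating_of_carrierSpec hC hD A f := hD.isNonDilating_pull A f`. [cite: MochizukiFrdI2008, Def. 1.1 (i) p.19] -/
theorem CarrierSpec.PullDichotomy.isNonDilating_pull {T' : RealifiedDivisorMonoids (D₀ := D₀) treeMonoidVocabWeak.{w}}
    {VD : FrdICatStub.{u, v, w} D} {C : TemperedFrobenioid T' D VD} (hD : CarrierSpec.PullDichotomy C)
    (A : Dᵒᵖ) (f : A ⟶ A) :
    treeMonoidVocabWeak.{w}.IsNonDilating (C.Φ.carrier A) (C.Φ.pull f) := by
  change IsNonDilating (C.Φ.pull f)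
  refine isNonDilating_of_forall_isPrimary (M := C.Φ.carrier A)
    (C.isPerfFactorial A).weak.isDivisorial.isSharp _ fun H => ?_
  rcases hD A f with hid | ⟨a, ha, hnot⟩
  · exact MonoidHom.ext hid
  · exact (hnot (H a ha)).elim

/-! ## The deck transformations lift BY NAME: the discharger of `CarrierSpec.lZ` (every model Frobenioid) -/

section DeckLift

variable {Φ B : Dᵒᵖ ⥤ CommMonCat.{w}} {DivB : B ⟶ monoidGp Φ}

/-- The LINEAR morphism `(1, f, 0, 1) : (A, 0) → (A′, 0)` of a model Frobenioid over a base morphism `f` ([FrdI]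
Thm. 5.2 (i); proof of Thm. 5.2 p.101: "the morphisms … such that `Div(φ) = 0`, `u_φ = 1`" between the
Frobenius-trivial objects `(A_D, 0)`). [cite: MochizukiFrdI2008, Thm. 5.2 (i) p.100] -/
noncomputable def linearHom {A A' : D} (f : A ⟶ A') :
    (⟨A, 1⟩ : ModelFrobenioid Φ B DivB) ⟶ ⟨A', 1⟩ :=
  ModelFrobenioid.mkHom _ _ 1 f 1 1 (by
    change (1 : Algebra.GrothendieckGroup (Φ.obj (op A))) ^ ((1 : ℕ+) : ℕ) * Algebra.GrothendieckGroup.of 1 =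
      pullGp Φ f 1 * divB Φ B DivB (op A) 1
    simp only [one_pow, map_one, mul_one])

/-- `(1, 𝟙, 0, 1) = 𝟙`. [cite: MochizukiFrdI2008, Thm. 5.2 (i) p.100] -/
theorem linearHom_id (A : D) : linearHom (𝟙 A) = 𝟙 (⟨A, 1⟩ : ModelFrobenioid Φ B DivB) :=
  ModelFrobenioid.hom_ext rfl rfl rfl rfl

/-- `(1, f ≫ g, 0, 1) = (1, f, 0, 1) ≫ (1, g, 0, 1)`. [cite: MochizukiFrdI2008, Thm. 5.2 (i) p.100] -/
theorem linearHom_comp {A A' A'' : D} (f : A ⟶ A') (g : A' ⟶ A'') :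
    (linearHom (f ≫ g) : (⟨A, 1⟩ : ModelFrobenioid Φ B DivB) ⟶ ⟨A'', 1⟩) = linearHom f ≫ linearHom g := by
  refine ModelFrobenioid.hom_ext rfl rfl ?_ ?_
  · rw [ModelFrobenioid.div_comp_pull]
    change (1 : Φ.obj (op A)) = pull Φ f 1 * 1 ^ ((1 : ℕ+) : ℕ)
    rw [map_one, one_pow, mul_one]
  · rw [ModelFrobenioid.unit_comp_pull]
    change (1 : B.obj (op A)) = pull B f 1 * 1 ^ ((1 : ℕ+) : ℕ)
    rw [map_one, one_pow, mul_one]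

/-- **The deck transformations of `A` lift BY NAME to the Frobenius-trivial object `(A, 0)`**: the group homomorphism
`Aut_D(A) → Aut_C((A, 0))`, `σ ↦ (1, σ, 0, 1)` ([FrdI] Thm. 5.2 (i); [IUTchI] Ex. 3.2 (ii) "`l·ℤ ⊆ Aut(T_{Ÿ_v})`" is
the image of the `l`-th powers of the deck translations of `Ÿ_v̲` under this map at `A := Ÿ_v̲`).
[cite: MochizukiFrdI2008, Thm. 5.2 (i) p.100] -/
noncomputable def deckLiftLin (A : D) : Aut A →* Aut (⟨A, 1⟩ : ModelFrobenioid Φ B DivB) where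
  toFun σ :=
    { hom := linearHom σ.hom
      inv := linearHom σ.inv
      hom_inv_id := by rw [← linearHom_comp, σ.hom_inv_id, linearHom_id]
      inv_hom_id := by rw [← linearHom_comp, σ.inv_hom_id, linearHom_id] }
  map_one' := Iso.ext (linearHom_id A)
  map_mul' σ τ := Iso.ext (by
    change linearHom (τ.hom ≫ σ.hom) = linearHom τ.hom ≫ linearHom σ.hom
    exact linearHom_comp τ.hom σ.hom)

/-- The lift of `σ` lies over `σ`, with trivial zero divisor and trivial unit. [cite: MochizukiFrdI2008, Thm. 5.2 (i) p.100] -/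
theorem deckLift_hom_base (A : D) (σ : Aut A) :
    ((deckLiftLin (Φ := Φ) (B := B) (DivB := DivB) A) σ).hom.base = σ.hom ∧
      ((deckLiftLin (Φ := Φ) (B := B) (DivB := DivB) A) σ).hom.div = 1 ∧
      ((deckLiftLin (Φ := Φ) (B := B) (DivB := DivB) A) σ).hom.unit = 1 :=
  ⟨rfl, rfl, rfl⟩

end DeckLift

/-- **`CarrierSpec.lZ` HOLDS for every tempered Frobenioid** (its named discharger: the canonical lift `deckLiftLin` at
`A := Ÿ_T`): the deck transformations `Aut_{𝒟_v̲}(Ÿ_T)` lift by name to `Aut(T_{Ÿ_T})`, `T_{Ÿ_T} = ⟨T.ydd, 1⟩`, over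
themselves with trivial zero divisor and unit; GA-06 sets `lZ :=` the image under `deckLiftLin T.ydd` of the `l`-th powers.
Stated for any base `D` and object `A`. [cite: MochizukiEtTh2009, Def 3.6 p.77] -/
theorem exists_deckLift (C : TemperedFrobenioid T' D VD) (A : D) :
    ∃ Λ : Aut A →* Aut (⟨A, 1⟩ : C.category),
      ∀ σ : Aut A, (Λ σ).hom.base = σ.hom ∧ (Λ σ).hom.div = 1 ∧ (Λ σ).hom.unit = 1 :=
  ⟨deckLiftLin A, fun _ => ⟨rfl, rfl, rfl⟩⟩

/-! ## The `aut_finite` clause HOLDS for every tempered Frobenioid over `CosetCat P`: its named discharger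
(an endomorphism of a FINITE-INDEX coset object is an automorphism, and `Φ` of it has finite order) -/

section AutFinite

variable {P : Type u} [Group P] [TopologicalSpace P]

/-- The underlying map of an ENDOmorphism `g·U ↦ g·h·U` of a coset object `P/U` is surjective (`k·U` is the image of
`k·h⁻¹·U`). [cite: MochizukiFrdII2008, Ex 1.3 (i) p.11] -/
theorem _root_.Literature.AnabelianGeometry.SemiGraphs.CosetCat.toFun_surjective_of_end {X : CosetCat P} (f : X ⟶ X) : Surjective (CosetCat.Hom.toFun f) := by
  intro y
  induction y using QuotientGroup.induction_on with
  | H k =>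
    obtain ⟨h, hh⟩ := Quotient.exists_rep (CosetCat.pt f)
    refine ⟨((k * h⁻¹ : P) : X.carrier), ?_⟩
    rw [CosetCat.toFun_coe, ← hh]
    change (k * h⁻¹) • ((h : P) : X.carrier) = (k : X.carrier)
    rw [MulAction.Quotient.smul_coe, smul_eq_mul, inv_mul_cancel_right]

/-- … hence BIJECTIVE when `U` has finite index (`P/U` finite). [cite: MochizukiFrdII2008, Ex 1.3 (i) p.11] -/
theorem _root_.Literature.AnabelianGeometry.SemiGraphs.CosetCat.toFun_bijective_of_end {X : CosetCat P} [X.sg.toSubgroup.FiniteIndex] (f : X ⟶ X) :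
    Bijective (CosetCat.Hom.toFun f) :=
  ⟨Finite.injective_iff_surjective.mpr (CosetCat.toFun_surjective_of_end f), CosetCat.toFun_surjective_of_end f⟩

/-- The `P`-equivariant bijection of `P/U` underlying an endomorphism of a finite-index coset object.
[cite: MochizukiFrdII2008, Ex 1.3 (i) p.11] -/
noncomputable def _root_.Literature.AnabelianGeometry.SemiGraphs.CosetCat.endPerm {X : CosetCat P} [X.sg.toSubgroup.FiniteIndex] (f : X ⟶ X) :
    Equiv.Perm X.carrier :=
  Equiv.ofBijective _ (CosetCat.toFun_bijective_of_end f)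

/-- The inverse bijection is again `P`-equivariant: an inverse morphism. [cite: MochizukiFrdII2008, Ex 1.3 (i) p.11] -/
noncomputable def _root_.Literature.AnabelianGeometry.SemiGraphs.CosetCat.endInv {X : CosetCat P} [X.sg.toSubgroup.FiniteIndex] (f : X ⟶ X) : X ⟶ X where
  toFun := (CosetCat.endPerm f).symm
  map_smul g x := by
    apply (CosetCat.endPerm f).injective
    rw [Equiv.apply_symm_apply]
    change g • x = CosetCat.Hom.toFun f (g • (CosetCat.endPerm f).symm x)
    rw [CosetCat.Hom.map_smul]
    exact (congrArg (g • ·) ((CosetCat.endPerm f).apply_symm_apply x)).symm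

/-- **An endomorphism of a finite-index object of `CosetCat P` is an automorphism** (`End_P(P/U) = N_P(U)/U`).
[cite: MochizukiFrdII2008, Ex 1.3 (i) p.11] -/
theorem _root_.Literature.AnabelianGeometry.SemiGraphs.CosetCat.isIso_of_end {X : CosetCat P} [X.sg.toSubgroup.FiniteIndex] (f : X ⟶ X) : IsIso f :=
  ⟨⟨CosetCat.endInv f,
    CosetCat.hom_ext_toFun fun x => (CosetCat.endPerm f).symm_apply_apply x,
    CosetCat.hom_ext_toFun fun x => (CosetCat.endPerm f).apply_symm_apply x⟩⟩

/-- The `k`-fold composite `f ≫ ⋯ ≫ f` of an endomorphism. [cite: MochizukiFrdII2008, Ex 1.3 (i) p.11] -/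
noncomputable def _root_.Literature.AnabelianGeometry.SemiGraphs.CosetCat.endIter {X : CosetCat P} (f : X ⟶ X) (k : ℕ) :
    X ⟶ X :=
  Nat.rec (𝟙 X) (fun _ g => g ≫ f) k

/-- The underlying map of the `k`-fold composite is the `k`-th iterate. [cite: MochizukiFrdII2008, Ex 1.3 (i) p.11] -/
theorem _root_.Literature.AnabelianGeometry.SemiGraphs.CosetCat.toFun_endIter {X : CosetCat P} (f : X ⟶ X) (k : ℕ) (x : X.carrier) :
    CosetCat.Hom.toFun (CosetCat.endIter f k) x = (CosetCat.Hom.toFun f)^[k] x := by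
  induction k generalizing x with
  | zero => rfl
  | succ k ih =>
    rw [iterate_succ_apply']
    change CosetCat.Hom.toFun f (CosetCat.Hom.toFun (CosetCat.endIter f k) x) = _
    rw [ih]

/-- **Some positive composite of an endomorphism of a finite-index object of `CosetCat P` is the identity** (its
underlying permutation of the finite set `P/U` has finite order). [cite: MochizukiFrdII2008, Ex 1.3 (i) p.11] -/
theorem _root_.Literature.AnabelianGeometry.SemiGraphs.CosetCat.exists_endIter_eq_id {X : CosetCat P} [X.sg.toSubgroup.FiniteIndex] (f : X ⟶ X) :
    ∃ n : ℕ, 0 < n ∧ CosetCat.endIter f n = 𝟙 X := by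
  refine ⟨orderOf (CosetCat.endPerm f), orderOf_pos _, CosetCat.hom_ext_toFun fun x => ?_⟩
  rw [CosetCat.toFun_endIter]
  change (⇑(CosetCat.endPerm f))^[orderOf (CosetCat.endPerm f)] x = x
  rw [Equiv.Perm.iterate_eq_pow, pow_orderOf_eq_one]
  rfl

section Pull

variable {E : Type*} [Category E] {Ψ : Eᵒᵖ ⥤ CommMonCat.{w}} (S : SubMonoidOn Ψ)

/-- Pull-back along a composite is the composite of the pull-backs. [cite: MochizukiEtTh2009, Def 3.6 p.76] -/
theorem _root_.Literature.AnabelianGeometry.EtaleTheta.SubMonoidOn.pull_comp_apply {A B C : Eᵒᵖ} (f : A ⟶ B) (g : B ⟶ C) (x : S.carrier A) :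
    S.pull (f ≫ g) x = S.pull g (S.pull f x) :=
  Subtype.ext (by
    change (Ψ.map (f ≫ g)).hom x.1 = (Ψ.map g).hom ((Ψ.map f).hom x.1)
    rw [Ψ.map_comp]
    rfl)

/-- Pull-back along the identity is the identity. [cite: MochizukiEtTh2009, Def 3.6 p.76] -/
theorem _root_.Literature.AnabelianGeometry.EtaleTheta.SubMonoidOn.pull_id_apply {A : Eᵒᵖ} (x : S.carrier A) : S.pull (𝟙 A) x = x :=
  Subtype.ext (by
    change (Ψ.map (𝟙 A)).hom x.1 = x.1
    rw [Ψ.map_id]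
    rfl)

end Pull

variable {VD₁ : FrdICatStub.{u, u, w} (CosetCat P)}

/-- Pull-back along the `k`-fold composite of `f` (read in `Dᵒᵖ`) is the `k`-th iterate of the pull-back along `f`.
[cite: MochizukiEtTh2009, Def 3.6 p.76] -/
theorem pull_op_endIter_apply (C : TemperedFrobenioid T' (CosetCat P) VD₁) {A : CosetCat P} (f : A ⟶ A) (k : ℕ)
    (a : C.Φ.carrier (op A)) : C.Φ.pull (CosetCat.endIter f k).op a = (⇑(C.Φ.pull f.op))^[k] a := by
  induction k generalizing a with
  | zero => exact C.Φ.pull_id_apply a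
  | succ k ih =>
    rw [iterate_succ_apply]
    change C.Φ.pull (f.op ≫ (CosetCat.endIter f k).op) a = _
    rw [C.Φ.pull_comp_apply, ih]

/-- **The `aut_finite` clause of `CarrierSpec` HOLDS for every tempered Frobenioid over `𝒟_v̲ = CosetCat P`** (its named
discharger): an endomorphism `f` of a FINITE-INDEX object `P/U` is an automorphism, and the endomorphism `Φ(f)` of `Φ(P/U)`
it induces has finite order (`Φ` is functorial and some positive composite of `f` is the identity).
[cite: MochizukiEtTh2009, Def 3.6 p.77] -/
theorem aut_finite_holds (C : TemperedFrobenioid T' (CosetCat P) VD₁) (A : CosetCat P) (f : A ⟶ A)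
    (hA : A.sg.toSubgroup.FiniteIndex) :
    IsIso f ∧ ∃ n : ℕ, 0 < n ∧ ∀ a : C.Φ.carrier (op A), (⇑(C.Φ.pull f.op))^[n] a = a := by
  obtain ⟨n, hn, hid⟩ := CosetCat.exists_endIter_eq_id f
  refine ⟨CosetCat.isIso_of_end f, n, hn, fun a => ?_⟩
  rw [← pull_op_endIter_apply C f n a, hid]
  exact C.Φ.pull_id_apply a


end AutFinite

end ArithThetaTower

end Literature.AnabelianGeometry.EtaleTheta
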